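import Summits.NavierStokesRegularity.FluidComputer.Reparam
import Mathlib.Analysis.Calculus.LocalExtr.Rolle
import Mathlib.Topology.MetricSpace.Pseudo.Lemmas
import HarnessLib

/-!
# `RowPhaseCont`: continuation of the locked phase map — UNIQUENESS and the LOCAL EXTENSION step
# (layer A′ of `pub-fluidc-bp3/R1-DESIGN.md` §11.7, items (G-a) and (G-c); pure one-variable analysis)

HONEST FRAMING (cell `pub-fluidc`, blueprint seat bp3, gen 22): low prior, high value-of-information
experiment on Tao's machine paradigm; NOT a claim that NS blows up. Nothing here mentions a fluid.

WHY. The phase map of a stage member is defined implicitly by the lock `ψ (s t) = χ t` (`ψ := y_p` the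
member's lock coordinate in its own clock, `χ := x̂_p` the reference's). `RowPhaseMap` shows that on a
monotonicity window the map `Reparam.inv ∘ χ` has every property `RowModel.MemberOn` asks of `s`. To run
that construction along a whole stage one continues it window by window, which needs two facts proved here
once, abstractly: (G-a) `phase_unique` — two continuous solutions of the lock with the same start, staying
in an open set `U` on which `ψ' ≠ 0`, coincide (real induction on `[T₀, τ]`: the coincidence set is closed,
and open to the right by local injectivity of `ψ` — Rolle); (G-c) `phase_extend` — at a time `τ` where the
lock holds with `s τ = σ₁ ∈ U`, there is a window `[a, b] ⊆ U` around `σ₁`, a sign `ε = ±1` making `ε·ψ`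
strictly increasing on it, and an `η > 0` such that the range condition `ε·χ t ∈ (ε ψ a, ε ψ b)` holds on
`[τ, τ + η]` and the new inverse starts at `σ₁` — exactly the hypotheses of
`RowModel.phaseLock_of_reparam`. Closedness (G-d) and the induction over rows (G-e) are not in this file.

[cite: Tao2016AveragedNS, §5.5 Thm 5.3 (5.5)]
-/

noncomputable section

open Set Filter Topology Metric

namespace Summit.NavierStokesRegularity.FluidComputer

namespace Reparam

/-- Rolle: a function with nowhere-zero derivative on `[a, b]` is injective there. [folklore] -/
theorem injOn_Icc_of_deriv_ne_zero {ψ ψ' : ℝ → ℝ} {a b : ℝ}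
    (hd : ∀ σ ∈ Icc a b, HasDerivAt ψ (ψ' σ) σ) (hne : ∀ σ ∈ Icc a b, ψ' σ ≠ 0) :
    InjOn ψ (Icc a b) := by
  have hc : ContinuousOn ψ (Icc a b) := fun σ hσ => (hd σ hσ).continuousAt.continuousWithinAt
  intro σ₁ h₁ σ₂ h₂ h
  by_contra hneq
  rcases lt_or_gt_of_ne hneq with hlt | hlt
  · obtain ⟨c, hc', hcd⟩ := exists_hasDerivAt_eq_zero (f := ψ) (f' := ψ') hlt
      (hc.mono (Icc_subset_Icc h₁.1 h₂.2)) h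
      (fun σ hσ => hd σ ⟨h₁.1.trans hσ.1.le, hσ.2.le.trans h₂.2⟩)
    exact hne c ⟨h₁.1.trans hc'.1.le, hc'.2.le.trans h₂.2⟩ hcd
  · obtain ⟨c, hc', hcd⟩ := exists_hasDerivAt_eq_zero (f := ψ) (f' := ψ') hlt
      (hc.mono (Icc_subset_Icc h₂.1 h₁.2)) h.symm
      (fun σ hσ => hd σ ⟨h₂.1.trans hσ.1.le, hσ.2.le.trans h₁.2⟩)
    exact hne c ⟨h₂.1.trans hc'.1.le, hc'.2.le.trans h₁.2⟩ hcd

/-- With a nowhere-zero derivative on `[a, b]`, `a ≤ b`, one of `±ψ` is continuous and strictly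
increasing there. [folklore] -/
theorem exists_sign_strictMonoOn {ψ ψ' : ℝ → ℝ} {a b : ℝ} (hab : a ≤ b)
    (hd : ∀ σ ∈ Icc a b, HasDerivAt ψ (ψ' σ) σ) (hne : ∀ σ ∈ Icc a b, ψ' σ ≠ 0) :
    ∃ ε : ℝ, (ε = 1 ∨ ε = -1) ∧ ContinuousOn (fun σ => ε * ψ σ) (Icc a b) ∧
      StrictMonoOn (fun σ => ε * ψ σ) (Icc a b) := by
  have hc : ContinuousOn ψ (Icc a b) := fun σ hσ => (hd σ hσ).continuousAt.continuousWithinAt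
  rcases hc.strictMonoOn_of_injOn_Icc' hab (injOn_Icc_of_deriv_ne_zero hd hne) with hm | hm
  · refine ⟨1, Or.inl rfl, continuousOn_const.mul hc, ?_⟩
    intro σ₁ h₁ σ₂ h₂ hlt
    simp only [one_mul]
    exact hm h₁ h₂ hlt
  · refine ⟨-1, Or.inr rfl, continuousOn_const.mul hc, ?_⟩
    intro σ₁ h₁ σ₂ h₂ hlt
    simp only [neg_mul, one_mul, neg_lt_neg_iff]
    exact hm h₁ h₂ hlt

/-- An open set contains a closed window `[σ − w, σ + w]`, `w > 0`, around each of its points. [folklore] -/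
theorem exists_Icc_subset_of_isOpen {U : Set ℝ} (hU : IsOpen U) {σ : ℝ} (hσ : σ ∈ U) :
    ∃ w > 0, Icc (σ - w) (σ + w) ⊆ U := by
  obtain ⟨ε, hε, hball⟩ := Metric.mem_nhds_iff.mp (hU.mem_nhds hσ)
  refine ⟨ε / 2, by positivity, fun x hx => hball ?_⟩
  rw [Metric.mem_ball, Real.dist_eq, abs_lt]
  constructor <;> linarith [hx.1, hx.2]

/-- **(G-a) Uniqueness of the locked phase map.** Two maps continuous on `[T₀, τ]`, the first with values
in an open set `U` on which `ψ' ≠ 0`, with the same lock `ψ (s₁ t) = ψ (s₂ t)` and the same start,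
coincide on `[T₀, τ]`. [folklore] -/
theorem phase_unique {ψ ψ' s₁ s₂ : ℝ → ℝ} {U : Set ℝ} {T₀ τ : ℝ} (hU : IsOpen U)
    (hd : ∀ σ ∈ U, HasDerivAt ψ (ψ' σ) σ) (hne : ∀ σ ∈ U, ψ' σ ≠ 0)
    (h1c : ContinuousOn s₁ (Icc T₀ τ)) (h2c : ContinuousOn s₂ (Icc T₀ τ))
    (h1U : ∀ t ∈ Icc T₀ τ, s₁ t ∈ U)
    (hlock : ∀ t ∈ Icc T₀ τ, ψ (s₁ t) = ψ (s₂ t)) (h0 : s₁ T₀ = s₂ T₀) :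
    ∀ t ∈ Icc T₀ τ, s₁ t = s₂ t := by
  set A : Set ℝ := {t | s₁ t = s₂ t} with hA
  have hcl : IsClosed (A ∩ Icc T₀ τ) := by
    have h := (h1c.sub h2c).preimage_isClosed_of_isClosed isClosed_Icc (isClosed_singleton (x := (0:ℝ)))
    have hset : A ∩ Icc T₀ τ = Icc T₀ τ ∩ (fun t => s₁ t - s₂ t) ⁻¹' {0} := by
      ext t
      simp only [hA, mem_inter_iff, mem_setOf_eq, mem_preimage, mem_singleton_iff, sub_eq_zero]
      exact and_comm
    rw [hset]; exact h
  have hstep : ∀ x ∈ A ∩ Ico T₀ τ, A ∈ 𝓝[>] x := by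
    rintro x ⟨hxA, hx⟩
    have hxI : x ∈ Icc T₀ τ := Ico_subset_Icc_self hx
    have hσU : s₁ x ∈ U := h1U x hxI
    obtain ⟨w, hw, hwin⟩ := exists_Icc_subset_of_isOpen hU hσU
    have hinj : InjOn ψ (Icc (s₁ x - w) (s₁ x + w)) :=
      injOn_Icc_of_deriv_ne_zero (fun σ hσ => hd σ (hwin hσ)) (fun σ hσ => hne σ (hwin hσ))
    obtain ⟨δ₁, hδ₁, h1⟩ := Metric.continuousWithinAt_iff.mp (h1c x hxI) w hw
    obtain ⟨δ₂, hδ₂, h2⟩ := Metric.continuousWithinAt_iff.mp (h2c x hxI) w hw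
    rw [mem_nhdsGT_iff_exists_Ioo_subset]
    refine ⟨min τ (x + min δ₁ δ₂), ?_, ?_⟩
    · show x < min τ (x + min δ₁ δ₂)
      exact lt_min hx.2 (by linarith [lt_min hδ₁ hδ₂])
    · intro t ht
      have htτ : t < τ := lt_of_lt_of_le ht.2 (min_le_left _ _)
      have htδ : t < x + min δ₁ δ₂ := lt_of_lt_of_le ht.2 (min_le_right _ _)
      have htI : t ∈ Icc T₀ τ := ⟨hxI.1.trans ht.1.le, htτ.le⟩
      have hdist : dist t x < min δ₁ δ₂ := by
        rw [Real.dist_eq, abs_lt]; constructor <;> linarith [ht.1, le_min hδ₁.le hδ₂.le]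
      have e1 := h1 htI (lt_of_lt_of_le hdist (min_le_left _ _))
      have e2 := h2 htI (lt_of_lt_of_le hdist (min_le_right _ _))
      rw [Real.dist_eq, abs_lt] at e1 e2
      have hx2 : s₂ x = s₁ x := hxA.symm
      rw [hx2] at e2
      show s₁ t = s₂ t
      exact hinj ⟨by linarith [e1.1], by linarith [e1.2]⟩ ⟨by linarith [e2.1], by linarith [e2.2]⟩
        (hlock t htI)
  have hsub := hcl.Icc_subset_of_forall_mem_nhdsWithin (show T₀ ∈ A from h0) hstep
  exact fun t ht => hsub ht

/-- **(G-c) The local extension step.** At a time `τ` where the lock `χ τ = ψ σ₁` holds with `σ₁` in an open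
set `U` on which `ψ' ≠ 0`, and `χ` is continuous from the right at `τ`: there are a window `[a, b] ⊆ U`
around `σ₁`, a sign `ε = ±1` with `ε·ψ` continuous and strictly increasing on it, and `η > 0` such that the
range condition of `RowModel.phaseLock_of_reparam` holds on `[τ, τ + η]` and the inverse starts at `σ₁`.
[folklore] -/
theorem phase_extend {ψ ψ' χ : ℝ → ℝ} {U : Set ℝ} {τ σ₁ : ℝ} (hU : IsOpen U)
    (hd : ∀ σ ∈ U, HasDerivAt ψ (ψ' σ) σ) (hne : ∀ σ ∈ U, ψ' σ ≠ 0) (hσ₁ : σ₁ ∈ U)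
    (hχc : ContinuousWithinAt χ (Ici τ) τ) (hχτ : χ τ = ψ σ₁) :
    ∃ a b ε η : ℝ, ∃ hab : a ≤ b, a < σ₁ ∧ σ₁ < b ∧ Icc a b ⊆ U ∧ (ε = 1 ∨ ε = -1) ∧ 0 < η ∧
      ∃ (hψc : ContinuousOn (fun σ => ε * ψ σ) (Icc a b))
        (hψm : StrictMonoOn (fun σ => ε * ψ σ) (Icc a b)),
        (∀ t ∈ Icc τ (τ + η), ε * χ t ∈ Ioo (ε * ψ a) (ε * ψ b)) ∧
          inv hab hψc hψm (ε * χ τ) = σ₁ := by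
  obtain ⟨w, hw, hwin⟩ := exists_Icc_subset_of_isOpen hU hσ₁
  have hab : σ₁ - w ≤ σ₁ + w := by linarith
  obtain ⟨ε, hε, hψc, hψm⟩ := exists_sign_strictMonoOn hab (fun σ hσ => hd σ (hwin hσ))
    (fun σ hσ => hne σ (hwin hσ))
  have hσI : σ₁ ∈ Icc (σ₁ - w) (σ₁ + w) := ⟨by linarith, by linarith⟩
  -- the open range around `ε ψ σ₁`
  have hlo : ε * ψ (σ₁ - w) < ε * ψ σ₁ := hψm ⟨le_rfl, hab⟩ hσI (by linarith)
  have hhi : ε * ψ σ₁ < ε * ψ (σ₁ + w) := hψm hσI ⟨hab, le_rfl⟩ (by linarith)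
  set g : ℝ := min (ε * ψ σ₁ - ε * ψ (σ₁ - w)) (ε * ψ (σ₁ + w) - ε * ψ σ₁) with hg
  have hg0 : 0 < g := lt_min (by linarith) (by linarith)
  -- continuity of `ε χ` from the right at `τ`
  have hχc' : ContinuousWithinAt (fun t => ε * χ t) (Ici τ) τ := continuousWithinAt_const.mul hχc
  obtain ⟨δ, hδ, hclose⟩ := Metric.continuousWithinAt_iff.mp hχc' g hg0
  refine ⟨σ₁ - w, σ₁ + w, ε, δ / 2, hab, by linarith, by linarith, hwin, hε, by positivity, hψc, hψm,
    ?_, ?_⟩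
  · intro t ht
    have hdist : dist t τ < δ := by
      rw [Real.dist_eq, abs_lt]; constructor <;> linarith [ht.1, ht.2]
    have h := hclose (show t ∈ Ici τ from ht.1) hdist
    rw [Real.dist_eq, abs_lt, hχτ] at h
    have hg1 : g ≤ ε * ψ σ₁ - ε * ψ (σ₁ - w) := min_le_left _ _
    have hg2 : g ≤ ε * ψ (σ₁ + w) - ε * ψ σ₁ := min_le_right _ _
    constructor <;> linarith [h.1, h.2]
  · rw [hχτ]
    exact inv_eq_of_eq hab hψc hψm hσI rfl

end Reparam

end Summit.NavierStokesRegularity.FluidComputer
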